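import Mathlib
import Literature.NumberTheory.Transcendental.KZCalculusProofs
import Literature.NumberTheory.Transcendental.KZLogCalculusProofs
import Literature.NumberTheory.Transcendental.KZSemialgebraicComplex
import Summits.KontsevichZagierPeriods.KontsevichZagierPeriods.Theorems.HyperbolicBlochOffTetraSectorKernelStubGoldenDilog

/-!
# `OffTetraSectorKernel`, line `odd-hyperbolic-ladder`: existence of the carriers
(stubs `stub_dilogCarrierExists`, `stub_logRectExists`, `stub_logBandExists`)

Three registered existence stubs of the crux `OffTetraSectorKernel`
(stmt-KontsevichZagierPeriods-10557, route HyperbolicBloch). Abel's five-term equation is run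
inside the Kontsevich–Zagier calculus on three kinds of carriers, and this file records that
each of them IS an integral representation (`KZ.IntegralRep`: `ℚ`-semialgebraic domain,
`ℚ`-semialgebraic integrand, absolutely convergent integral):

* the DILOGARITHM TRIANGLE `[T(a), 1/(u(1 − t))]`, `T(a) = {0 < t < u < a}`, for real algebraic
  `0 < a < 1` (value `Li₂(a)`): on the fibre `0 ≤ t ≤ u` the integrand is at most `1/(u(1 − a))`,
  so the fibre integral is at most `1/(1 − a)` (`KZlog.integrableOn_band_of_lintegral_fibre_le`
  on the closed-fibre band `{0 < u < a, 0 ≤ t ≤ u}`, then restriction to the open triangle);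
* the LOG RECTANGLE `[(1,a) × (1,b), 1/(u w)]` for real algebraic `a, b ≥ 1`
  (value `log a · log b`): a bounded integrand (`≤ 1`) on a bounded box;
* the UNFOLDED LOGARITHM `[{x ∈ σ, 1 ≤ w ≤ v(x)}, g(x)/w]` (value `∫_σ g log v`) for `σ`
  `ℚ`-semialgebraic of finite measure, `g`, `v` `ℚ`-semialgebraic on `σ`, `v ≥ 1`, `|g| log v`
  bounded on `σ`: this is literally the unfolding `KZlog.IntegralRep.monomialRep` of the
  admissible logarithmic term `[σ; 0; (g, v)]` of `KZLogCalculus.lean` (the fibre integral of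
  `|g(x)/w|` over `[1, v(x)]` is `|g(x)| log v(x)`).

References: M. Kontsevich, D. Zagier, *Periods* (2001), §1.1 ("introducing more variables";
`log 2 = ∫₁² dx/x`); J. Bochnak, M. Coste, M.-F. Roy, *Real Algebraic Geometry* (1998), §2.2.
No definitions are introduced.
-/

noncomputable section

open Set MeasureTheory MvPolynomial
open Literature.NumberTheory.Transcendental Literature.ModelTheory.ExponentialFields

namespace Summit.KontsevichZagierPeriods.HyperbolicBloch.OffTetraSectorKernel

/-! ### The unfolded logarithm `[{x ∈ σ, 1 ≤ w ≤ v(x)}, g(x)/w]` -/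

/-- A bounded monomial `g log v` (`v ≥ 1`, `|g| log v ≤ C`) with `ℚ`-semialgebraic `g`, `v` on a
`ℚ`-semialgebraic set `σ` of finite measure is absolutely integrable on `σ`. [folklore] -/
theorem logBand_integrableOn_monomial {m : ℕ} {σ : Set (Fin m → ℝ)} {g v : (Fin m → ℝ) → ℝ}
    {C : ℝ} (hσ : IsSemialgebraic ℚ σ) (hvol : volume σ ≠ ⊤) (hg : IsSemialgebraicFunOn ℚ σ g)
    (hv : IsSemialgebraicFunOn ℚ σ v) (hv1 : ∀ p ∈ σ, 1 ≤ v p)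
    (hC : ∀ p ∈ σ, |g p| * Real.log (v p) ≤ C) :
    IntegrableOn (fun x => g x * Real.log (v x)) σ := by
  have hσm : MeasurableSet σ := IsSemialgebraic.measurableSet_holds hσ
  have hgm : AEStronglyMeasurable g (volume.restrict σ) :=
    KZ.aestronglyMeasurable_of_isSemialgebraicFunOn hg hσm
  have hvm : AEStronglyMeasurable v (volume.restrict σ) :=
    KZ.aestronglyMeasurable_of_isSemialgebraicFunOn hv hσm
  have hlm : AEStronglyMeasurable (fun x => Real.log (v x)) (volume.restrict σ) :=
    (Real.measurable_log.comp_aemeasurable hvm.aemeasurable).aestronglyMeasurable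
  have hconst : IntegrableOn (fun _ : Fin m → ℝ => C) σ := integrableOn_const hvol
  refine Integrable.mono' hconst (hgm.mul hlm) ?_
  refine (ae_restrict_iff' hσm).2 (Filter.Eventually.of_forall fun x hx => ?_)
  rw [norm_mul, Real.norm_eq_abs, Real.norm_eq_abs, abs_of_nonneg (Real.log_nonneg (hv1 x hx))]
  exact hC x hx

/-- STUB `stub_logBandExists`: the UNFOLDED LOGARITHM `[{x ∈ σ, 1 ≤ w ≤ v(x)}, g(x)/w]` (value
`∫_σ g log v`) IS an integral representation as soon as `σ` is `ℚ`-semialgebraic of finite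
measure, `g`, `v` are `ℚ`-semialgebraic on `σ`, `v ≥ 1`, and `|g| log v` is bounded on `σ`: it is
the unfolding (`KZlog.IntegralRep.monomialRep`) of the admissible logarithmic term
`[σ; 0; (g, v)]` (the fibre integral of `|g(x)/w|` over `[1, v(x)]` is `|g(x)| log v(x)`;
`KZlog.integrableOn_band_of_lintegral_fibre_le`). [cite: KontsevichZagier2001, §1.1] -/
theorem stub_logBandExists :
    ∀ (m : ℕ) (σ : Set (Fin m → ℝ)) (g v : (Fin m → ℝ) → ℝ) (C : ℝ),
      Literature.ModelTheory.ExponentialFields.IsSemialgebraic ℚ σ → MeasureTheory.volume σ ≠ ⊤ →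
      IsSemialgebraicFunOn ℚ σ g → IsSemialgebraicFunOn ℚ σ v → (∀ p ∈ σ, 1 ≤ v p) →
      (∀ p ∈ σ, |g p| * Real.log (v p) ≤ C) →
      ∃ B : KZ.IntegralRep (m + 1),
        B.domain = {z | (Fin.init z : Fin m → ℝ) ∈ σ ∧ 1 ≤ z (Fin.last m) ∧ z (Fin.last m) ≤ v (Fin.init z)} ∧
        B.integrand = fun z => g (Fin.init z) / z (Fin.last m) := by
  intro m σ g v C hσ hvol hg hv hv1 hC
  have hmono : IntegrableOn (fun x => g x * Real.log (v x)) σ :=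
    logBand_integrableOn_monomial hσ hvol hg hv hv1 hC
  have hadm : (⟨σ, fun _ => 0, 1, fun _ => g, fun _ => v⟩ : KZlog.Term m).Admissible :=
    { isSemialgebraic_domain := hσ
      isSemialgebraicFunOn_h₀ := isSemialgebraicFunOn_const_of_isAlgebraic hσ isAlgebraic_zero
      integrableOn_h₀ := integrableOn_zero
      isSemialgebraicFunOn_h := fun _ => hg
      isSemialgebraicFunOn_v := fun _ => hv
      one_le_v := fun _ => hv1
      integrableOn_monomial := fun _ => hmono }
  exact ⟨KZlog.IntegralRep.monomialRep ⟨_, hadm⟩ ⟨0, Nat.one_pos⟩, rfl, rfl⟩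

/-! ### The log rectangle `[(1,a) × (1,b), 1/(u w)]` -/

/-- The box `(1,a) × (1,b)` is `ℚ`-semialgebraic for real-algebraic `a`, `b` (real algebraic
constants are `ℚ`-definable). [cite: KontsevichZagier2001, §1.1] -/
theorem logRect_isSemialgebraic {a b : ℝ} (ha : IsAlgebraic ℚ a) (hb : IsAlgebraic ℚ b) :
    IsSemialgebraic ℚ {w : Fin 2 → ℝ | 1 < w 0 ∧ w 0 < a ∧ 1 < w 1 ∧ w 1 < b} := by
  have hU : IsSemialgebraic ℚ (univ : Set (Fin 2 → ℝ)) := isSemialgebraic_univ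
  have hco : ∀ i : Fin 2, IsSemialgebraicFunOn ℚ (univ : Set (Fin 2 → ℝ)) (fun p => p i) :=
    fun i => isSemialgebraicFunOn_apply hU i
  have h1 : IsSemialgebraicFunOn ℚ (univ : Set (Fin 2 → ℝ)) (fun _ => (1 : ℝ)) :=
    isSemialgebraicFunOn_const_of_isAlgebraic hU isAlgebraic_one
  have S1 : IsSemialgebraic ℚ {p : Fin 2 → ℝ | 1 < p 0} :=
    isSemialgebraic_setOf_lt_of_isSemialgebraicFunOn h1 (hco 0)
  have S2 : IsSemialgebraic ℚ {p : Fin 2 → ℝ | p 0 < a} :=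
    isSemialgebraic_setOf_lt_of_isSemialgebraicFunOn (hco 0)
      (isSemialgebraicFunOn_const_of_isAlgebraic hU ha)
  have S3 : IsSemialgebraic ℚ {p : Fin 2 → ℝ | 1 < p 1} :=
    isSemialgebraic_setOf_lt_of_isSemialgebraicFunOn h1 (hco 1)
  have S4 : IsSemialgebraic ℚ {p : Fin 2 → ℝ | p 1 < b} :=
    isSemialgebraic_setOf_lt_of_isSemialgebraicFunOn (hco 1)
      (isSemialgebraicFunOn_const_of_isAlgebraic hU hb)
  convert S1.inter (S2.inter (S3.inter S4)) using 1
  ext w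
  simp only [mem_inter_iff, mem_setOf_eq]

/-- The box `(1,a) × (1,b) ⊆ ℝ²` has finite volume (it is bounded). [folklore] -/
theorem logRect_volume_ne_top (a b : ℝ) :
    volume {w : Fin 2 → ℝ | 1 < w 0 ∧ w 0 < a ∧ 1 < w 1 ∧ w 1 < b} ≠ ⊤ := by
  refine (Bornology.IsBounded.measure_lt_top ?_).ne
  refine (Metric.isBounded_Icc (fun _ : Fin 2 => (1 : ℝ)) ![a, b]).subset ?_
  rintro w ⟨h1, h2, h3, h4⟩
  refine ⟨fun i => ?_, fun i => ?_⟩ <;> fin_cases i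
  · exact h1.le
  · exact h3.le
  · exact h2.le
  · exact h4.le

/-- STUB `stub_logRectExists`: the log rectangle `[(1,a) × (1,b), 1/(uw)]` (value `log a · log b`)
IS an integral representation for real algebraic `a, b ≥ 1`: the box is `ℚ`-semialgebraic,
`1/(uw)` is a rational function with non-vanishing denominator on it, bounded by `1`, and the
box is bounded. [cite: KontsevichZagier2001, §1.1] -/
theorem stub_logRectExists :
    ∀ a b : ℝ, IsAlgebraic ℚ a → IsAlgebraic ℚ b → 1 ≤ a → 1 ≤ b →
      ∃ N : KZ.IntegralRep 2, N.domain = {w | 1 < w 0 ∧ w 0 < a ∧ 1 < w 1 ∧ w 1 < b} ∧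
        N.integrand = fun w => 1 / (w 0 * w 1) := by
  intro a b ha hb _ _
  have hS := logRect_isSemialgebraic ha hb
  have hSm : MeasurableSet {w : Fin 2 → ℝ | 1 < w 0 ∧ w 0 < a ∧ 1 < w 1 ∧ w 1 < b} :=
    IsSemialgebraic.measurableSet_holds hS
  have hq : ∀ w ∈ {w : Fin 2 → ℝ | 1 < w 0 ∧ w 0 < a ∧ 1 < w 1 ∧ w 1 < b},
      aeval w (X 0 * X 1 : MvPolynomial (Fin 2) ℚ) ≠ 0 := by
    rintro w ⟨h1, -, h3, -⟩
    have h : (0 : ℝ) < w 0 * w 1 := mul_pos (one_pos.trans h1) (one_pos.trans h3)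
    simpa only [map_mul, MvPolynomial.aeval_X] using h.ne'
  have hf : IsSemialgebraicFunOn ℚ {w : Fin 2 → ℝ | 1 < w 0 ∧ w 0 < a ∧ 1 < w 1 ∧ w 1 < b}
      (fun w => 1 / (w 0 * w 1)) :=
    (isSemialgebraicFunOn_aeval_div_aeval hS 1 _ hq).congr fun w _ => by simp
  have hWm : Measurable (fun w : Fin 2 → ℝ => 1 / (w 0 * w 1)) :=
    measurable_const.div ((measurable_pi_apply 0).mul (measurable_pi_apply 1))
  have hint : IntegrableOn (fun w : Fin 2 → ℝ => 1 / (w 0 * w 1))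
      {w : Fin 2 → ℝ | 1 < w 0 ∧ w 0 < a ∧ 1 < w 1 ∧ w 1 < b} := by
    refine Measure.integrableOn_of_bounded (M := 1) (logRect_volume_ne_top a b)
      hWm.aestronglyMeasurable ?_
    refine (ae_restrict_iff' hSm).2 (Filter.Eventually.of_forall ?_)
    rintro w ⟨h1, -, h3, -⟩
    have hpos : (0 : ℝ) < w 0 * w 1 := mul_pos (one_pos.trans h1) (one_pos.trans h3)
    have hge : (1 : ℝ) ≤ w 0 * w 1 := by nlinarith
    rw [Real.norm_eq_abs, abs_of_pos (one_div_pos.2 hpos), div_le_one hpos]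
    exact hge
  exact ⟨⟨_, _, hS, hf, hint⟩, rfl, rfl⟩

/-! ### The dilogarithm triangle `[T(a), 1/(u(1 − t))]` -/

/-- The open interval `{0 < u < a} ⊆ ℝ¹` is `ℚ`-semialgebraic for real-algebraic `a`.
[cite: KontsevichZagier2001, §1.1] -/
theorem dilogCarrier_isSemialgebraic_base {a : ℝ} (ha : IsAlgebraic ℚ a) :
    IsSemialgebraic ℚ {x : Fin 1 → ℝ | 0 < x 0 ∧ x 0 < a} := by
  have hU : IsSemialgebraic ℚ (univ : Set (Fin 1 → ℝ)) := isSemialgebraic_univ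
  have hc : IsSemialgebraicFunOn ℚ (univ : Set (Fin 1 → ℝ)) (fun p => p 0) :=
    isSemialgebraicFunOn_apply hU 0
  have S1 : IsSemialgebraic ℚ {p : Fin 1 → ℝ | 0 < p 0} :=
    isSemialgebraic_setOf_lt_of_isSemialgebraicFunOn
      (isSemialgebraicFunOn_const_of_isAlgebraic hU isAlgebraic_zero) hc
  have S2 : IsSemialgebraic ℚ {p : Fin 1 → ℝ | p 0 < a} :=
    isSemialgebraic_setOf_lt_of_isSemialgebraicFunOn hc
      (isSemialgebraicFunOn_const_of_isAlgebraic hU ha)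
  convert S1.inter S2 using 1
  ext p
  simp only [mem_inter_iff, mem_setOf_eq]

/-- Integrability of `1/(u(1 − t))` on the closed-fibre dilogarithm band `{0 < u < a, 0 ≤ t ≤ u}`
for `a < 1`: on the fibre over `u` the integrand is at most `1/(u(1 − a))`, so the fibre
integral is at most `u · 1/(u(1 − a)) = 1/(1 − a)`, a constant, integrable on the bounded base
(`KZlog.integrableOn_band_of_lintegral_fibre_le`). [folklore] -/
theorem dilogCarrier_integrableOn_band {a : ℝ} (ha : IsAlgebraic ℚ a) (ha1 : a < 1) :
    IntegrableOn (fun w : Fin 2 → ℝ => 1 / (w 0 * (1 - w 1)))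
      (KZlog.band {x : Fin 1 → ℝ | 0 < x 0 ∧ x 0 < a} (fun _ => 0) (fun x => x 0)) := by
  have hS : IsSemialgebraic ℚ {x : Fin 1 → ℝ | 0 < x 0 ∧ x 0 < a} :=
    dilogCarrier_isSemialgebraic_base ha
  have hSm : MeasurableSet {x : Fin 1 → ℝ | 0 < x 0 ∧ x 0 < a} :=
    IsSemialgebraic.measurableSet_holds hS
  have hB : IsSemialgebraic ℚ
      (KZlog.band {x : Fin 1 → ℝ | 0 < x 0 ∧ x 0 < a} (fun _ => 0) (fun x => x 0)) :=
    KZlog.isSemialgebraic_band (isSemialgebraicFunOn_const_of_isAlgebraic hS isAlgebraic_zero)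
      (isSemialgebraicFunOn_apply hS 0)
  have hBm : MeasurableSet
      (KZlog.band {x : Fin 1 → ℝ | 0 < x 0 ∧ x 0 < a} (fun _ => 0) (fun x => x 0)) :=
    IsSemialgebraic.measurableSet_holds hB
  have hWm : Measurable (fun w : Fin 2 → ℝ => 1 / (w 0 * (1 - w 1))) :=
    measurable_const.div ((measurable_pi_apply 0).mul (measurable_const.sub (measurable_pi_apply 1)))
  have h1a : 0 < 1 - a := by linarith
  have hvol : volume {x : Fin 1 → ℝ | 0 < x 0 ∧ x 0 < a} ≠ ⊤ := by
    refine (Bornology.IsBounded.measure_lt_top ?_).ne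
    refine (Metric.isBounded_Icc (fun _ : Fin 1 => (0 : ℝ)) (fun _ => a)).subset ?_
    rintro x ⟨h1, h2⟩
    refine ⟨fun i => ?_, fun i => ?_⟩
    · obtain rfl : i = 0 := Subsingleton.elim _ _
      exact h1.le
    · obtain rfl : i = 0 := Subsingleton.elim _ _
      exact h2.le
  have hfib : ∀ x ∈ {x : Fin 1 → ℝ | 0 < x 0 ∧ x 0 < a},
      ∫⁻ t in Icc (0 : ℝ) (x 0),
        ‖(1 : ℝ) / ((Fin.snoc x t : Fin 2 → ℝ) 0 * (1 - (Fin.snoc x t : Fin 2 → ℝ) 1))‖ₑ ≤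
        ‖(1 : ℝ) / (1 - a)‖ₑ := by
    rintro x ⟨hx0, hxa⟩
    have hle : ∀ t ∈ Icc (0 : ℝ) (x 0),
        ‖(1 : ℝ) / ((Fin.snoc x t : Fin 2 → ℝ) 0 * (1 - (Fin.snoc x t : Fin 2 → ℝ) 1))‖ₑ ≤
          ENNReal.ofReal (1 / (x 0 * (1 - a))) := by
      intro t ht
      have e0 : (Fin.snoc x t : Fin 2 → ℝ) 0 = x 0 := rfl
      have e1 : (Fin.snoc x t : Fin 2 → ℝ) 1 = t := rfl
      rw [e0, e1]
      have hpos : 0 < x 0 * (1 - t) := mul_pos hx0 (by linarith [ht.2])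
      rw [Real.enorm_eq_ofReal (one_div_pos.2 hpos).le]
      exact ENNReal.ofReal_le_ofReal (one_div_le_one_div_of_le (mul_pos hx0 h1a)
        (mul_le_mul_of_nonneg_left (by linarith [ht.2]) hx0.le))
    calc ∫⁻ t in Icc (0 : ℝ) (x 0),
          ‖(1 : ℝ) / ((Fin.snoc x t : Fin 2 → ℝ) 0 * (1 - (Fin.snoc x t : Fin 2 → ℝ) 1))‖ₑ
        ≤ ∫⁻ _ in Icc (0 : ℝ) (x 0), ENNReal.ofReal (1 / (x 0 * (1 - a))) :=
          setLIntegral_mono' measurableSet_Icc hle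
      _ = ENNReal.ofReal (1 / (x 0 * (1 - a))) * ENNReal.ofReal (x 0 - 0) := by
          rw [setLIntegral_const, Real.volume_Icc]
      _ = ENNReal.ofReal (1 / (1 - a)) := by
          rw [← ENNReal.ofReal_mul (one_div_pos.2 (mul_pos hx0 h1a)).le, sub_zero,
            div_mul_eq_mul_div, one_mul, div_mul_cancel_left₀ hx0.ne', one_div]
      _ = ‖(1 : ℝ) / (1 - a)‖ₑ := (Real.enorm_eq_ofReal (one_div_pos.2 h1a).le).symm
  exact KZlog.integrableOn_band_of_lintegral_fibre_le hSm hBm (fun x t => KZlog.snoc_mem_band)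
    hWm.aestronglyMeasurable hfib (integrableOn_const hvol)

/-- STUB `stub_dilogCarrierExists`: the dilogarithm triangle `[T(a), 1/(u(1−t))]` IS an integral
representation for real algebraic `0 < a < 1` (semialgebraic data; absolutely integrable: on the
fibre `0 < t < u` the integrand is at most `1/(u(1−a))`, fibre integral `≤ 1/(1−a)`; the open
triangle sits inside the closed-fibre band `{0 < u < a, 0 ≤ t ≤ u}`).
[cite: KontsevichZagier2001, §1.1] -/
theorem stub_dilogCarrierExists :
    ∀ a : ℝ, IsAlgebraic ℚ a → 0 < a → a < 1 →
      ∃ L : KZ.IntegralRep 2, L.domain = {w | 0 < w 1 ∧ w 1 < w 0 ∧ w 0 < a} ∧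
        L.integrand = fun w => 1 / (w 0 * (1 - w 1)) := by
  intro a ha _ ha1
  have hT := goldenDilog_isSemialgebraic_triangle ha
  have hq : ∀ w ∈ {w : Fin 2 → ℝ | 0 < w 1 ∧ w 1 < w 0 ∧ w 0 < a},
      aeval w (X 0 * (1 - X 1) : MvPolynomial (Fin 2) ℚ) ≠ 0 := by
    rintro w ⟨h1, h2, h3⟩
    have h : (0 : ℝ) < w 0 * (1 - w 1) := mul_pos (h1.trans h2) (by linarith)
    simpa only [map_mul, map_sub, map_one, MvPolynomial.aeval_X] using h.ne'
  have hf : IsSemialgebraicFunOn ℚ {w : Fin 2 → ℝ | 0 < w 1 ∧ w 1 < w 0 ∧ w 0 < a}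
      (fun w => 1 / (w 0 * (1 - w 1))) :=
    (isSemialgebraicFunOn_aeval_div_aeval hT 1 _ hq).congr fun w _ => by simp
  have hint : IntegrableOn (fun w : Fin 2 → ℝ => 1 / (w 0 * (1 - w 1)))
      {w : Fin 2 → ℝ | 0 < w 1 ∧ w 1 < w 0 ∧ w 0 < a} := by
    refine (dilogCarrier_integrableOn_band ha ha1).mono_set ?_
    rintro w ⟨h1, h2, h3⟩
    exact ⟨⟨h1.trans h2, h3⟩, h1.le, h2.le⟩
  exact ⟨⟨_, _, hT, hf, hint⟩, rfl, rfl⟩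

end Summit.KontsevichZagierPeriods.HyperbolicBloch.OffTetraSectorKernel

end
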